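import Literature.AnabelianGeometry.EtaleTheta.Discharge.Sec5OfThetaSetting
import Literature.AnabelianGeometry.SemiGraphs.TemperedOpenMapping

/-!
# [EtTh] §5 data OF THE SETTING: the augmentation `Π^tp_X̲̲ ↠ G_K` is OPEN and `Π^tp_Ÿ̲̲ ↠ G_K` is ONTO (p.322 / PDF p.96)

Mochizuki, *The étale theta function …*, Publ. RIMS **45** (2009), §5 p.322 (PDF p.96): "`X̲̲^log`, … [each of which is geometrically
connected over the field `K = K̈`]"; Def. 2.5 (i) / p.267 (PDF p.41) (`Ÿ̲̲ → Ÿ`); [SemiAnbd] Ex. 3.10 p.43 ("`1 → Δ → Π → G_K → 1`").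
[cite: MochizukiEtTh2009, §5 p.322 (PDF p.96)] [cite: MochizukiSemiAnbd2006, Ex 3.10 p.43]

abc-iut cell, layer L2, seat abc-iut-L2-t4 (§5 owner, gen 4), ROW W3-L2-01; PROOF-ONLY sequel of `Discharge/Sec5OfThetaSetting.lean`
(p433549), answering abc-iut-w4-d008 (gen 4, STATUS 09:18:29Z): the two Π-side inputs `haug : IsOpenMap X.aug` and `hYdd` («`Π^tp_Ÿ` maps
onto `G_K`») of its discharge of `hΔcnst`/`hcnst`/`hfac` (`Sec5OriginClausesOfPushforward.lean`, p433787) are THEOREMS for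
`X := DoubleUnderline.temperedArithmeticGroup C e`:
* `isOpenMap_aug_temperedArithmeticGroup` — abc-iut-L3's open mapping theorem for tempered groups
  (`TemperedArithmeticGroup.augIsOpenMap_holds`, `SemiGraphs/TemperedOpenMapping.lean`) applied to the Ex. 3.10 datum of `X̲̲`;
* `map_aug_PiYdd_temperedArithmeticGroup_eq_top` — `aug(Π^tp_Ÿ̲̲) = Gal(K̄/K)` (abc-iut-L2-t8's field `map_aug_Ydduu`
  "`Ÿ̲̲` is geometrically connected over `K`", read through the bridge identification `e.galEquiv`), also in the `T.PiYdd`-spelling of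
  the §2 datum `C.thetaEnvData μ hC hS`.
Nothing landed is edited; no definition; no side taken on [IUTchIII] Cor. 3.12; typed ≠ proved.
-/

noncomputable section

namespace Literature.AnabelianGeometry.EtaleTheta

open Literature.AnabelianGeometry.SemiGraphs

namespace ThetaSetting.EtaleThetaData.DoubleUnderline

variable {p : ℕ} [Fact p.Prime] {D : ThetaSetting p} {E : D.EtaleThetaData} {l : ℕ} (C : E.DoubleUnderline l)
  (e : D.toTemperedCurve.GroupLevelData)

/-- **`aug : Π^tp_X̲̲ ↠ Gal(K̄/K)` is an open map** for the Ex. 3.10 datum of `X̲̲` ([SemiAnbd] Ex. 3.10: the sequence `1 → Δ → Π → G_K → 1`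
is topologically exact; abc-iut-L3's `augIsOpenMap_holds`).  [cite: MochizukiSemiAnbd2006, Ex 3.10 p.43] -/
theorem isOpenMap_aug_temperedArithmeticGroup : IsOpenMap (C.temperedArithmeticGroup e).aug :=
  (C.temperedArithmeticGroup e).augIsOpenMap_holds

/-- **`aug(Π^tp_Ÿ̲̲) = Gal(K̄/K)`**: the subgroup `Π^tp_Ÿ̲̲ = Π^tp_Ÿ ∩ Π^tp_X̲̲` of the Ex. 3.10 datum of `X̲̲` maps ONTO the absolute Galois group
("`Ÿ̲̲` … geometrically connected over `K`", abc-iut-L2-t8's field `map_aug_Ydduu`, through `e.galEquiv : G_K ≃ Gal(K̄/K)`).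
[cite: MochizukiEtTh2009, §5 p.322 (PDF p.96)] -/
theorem map_aug_PiYdd_temperedArithmeticGroup_eq_top :
    (D.GtpYdd.subgroupOf C.Huu).map (C.temperedArithmeticGroup e).aug.toMonoidHom = ⊤ := by
  rw [eq_top_iff]
  rintro γ -
  have hγ : ((e.galEquiv.symm γ : D.toTemperedCurve.GK) : GQp p) ∈ (D.GtpYdd ⊓ C.Huu).map D.aug.toMonoidHom := by
    rw [C.map_aug_Ydduu]; exact (e.galEquiv.symm γ).2
  obtain ⟨g, hg, hgγ⟩ := hγ
  refine ⟨⟨g, hg.2⟩, Subgroup.mem_subgroupOf.2 hg.1, ?_⟩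
  have h1 : D.toTemperedCurve.augGK g = e.galEquiv.symm γ := Subtype.ext (by simpa using hgγ)
  change e.galEquiv (D.toTemperedCurve.augGK g) = γ
  rw [h1, e.galEquiv.apply_symm_apply]

/-- The same in the spelling of the §2 datum: `T.PiYdd` of `C.thetaEnvData μ hC hS` maps onto `Gal(K̄/K)` under the augmentation of
`X := C.temperedArithmeticGroup e` (`T.PiYdd = Π^tp_Ÿ.subgroupOf Π^tp_X̲̲` definitionally).  [cite: MochizukiEtTh2009, Def 2.13 p.273 (PDF p.47)] -/
theorem map_aug_thetaEnvData_PiYdd_eq_top {N : ℕ+} (μ : D.CyclotomeMod l N) (hC : D.Compat) (hS : D.Sec2Hyps) :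
    ((C.thetaEnvData μ hC hS).PiYdd).map (C.temperedArithmeticGroup e).aug.toMonoidHom = ⊤ :=
  C.map_aug_PiYdd_temperedArithmeticGroup_eq_top e

/-- `aug(Π^tp_X̲̲) = Gal(K̄/K)` for the Ex. 3.10 datum of `X̲̲` (surjectivity, field form). [cite: MochizukiEtTh2009, §5 p.322 (PDF p.96)] -/
theorem range_aug_temperedArithmeticGroup_eq_top : (C.temperedArithmeticGroup e).aug.toMonoidHom.range = ⊤ :=
  MonoidHom.range_eq_top.2 (C.temperedArithmeticGroup e).aug_surjective

end ThetaSetting.EtaleThetaData.DoubleUnderline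

end Literature.AnabelianGeometry.EtaleTheta

end
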